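import Summits.CriticalPhenomena.Ising3DConformalLimit.Theorems.HyperoctahedralRPExistsScaleCovariantLimitFoldedCurrentUniqueness
import Summits.CriticalPhenomena.Ising3DConformalLimit.Theorems.HyperoctahedralRPExistsScaleCovariantLimitDoublingOfDyadicPairRatio
import Summits.CriticalPhenomena.Ising3DConformalLimit.Theses.PositivityBegetsConformality
import HarnessLib

/-!
# F4' at order two: the two-point IMAGE of the cluster set, and an exact re-split of the crux
# (crux `ExistsScaleCovariantLimit`, item stmt-CriticalPhenomena-1981, line `folded-current-repulsion`; lead c18)

Route `HyperoctahedralRP` / `PositivityBegetsConformality` (sub-problem `CriticalPhenomena/Ising3DConformalLimit`). The line's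
second registered stub F4' is item stmt-CriticalPhenomena-4659 `ClusterRigidity.ClusterSetTotallyDisconnected` verbatim, whose own
birth skeleton (`Cruxes/ClusterSetTotallyDisconnected/Lines/birth.lean`) cuts it along the two-point projection `π₂ : S ↦ S 2`
into `stub_twoPointImageTD` (the set `π₂ '' 𝒞` of two-point functions of cluster points of the self-normalised critical `ℤ³`
Ising correlators is totally disconnected in the pointwise topology) and `stub_fibrewiseTD` (every fibre `{S ∈ 𝒞 | S 2 = G}` is
totally disconnected). This file lands the ORDER-TWO DICTIONARY of the first cut, kernel-checked, and the re-split of the crux it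
gives (statements of 4659's stubs restated verbatim; no definition is introduced):

* `clusterPointUniqueTwo_of_orbitPrecompact_of_twoPointImageTD` — **item 5955 `OrbitPrecompact` ∧ `stub_twoPointImageTD` ⟹
  any two cluster points of the pinned zoom have the same two-point function off the diagonal** (c11's "connected inside totally
  disconnected" argument for `clusterPointUnique_of_orbitPrecompact_of_totallyDisconnected`, read through the continuous
  coordinate projection `π₂` of the product topology);
* `pointwiseLimitTwo_of_orbitPrecompact_of_clusterPointUniqueTwo` — item 5955 ∧ uniqueness at order two ⟹ **the pinned
  two-point function converges along the full filter `δ → 0⁺`** (item 6153 `PointwiseLimit` AT ORDER TWO; sequential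
  characterisation of `𝓝[>] 0` + tightness);
* `twoPointImageTD_of_pointwiseLimitTwo` (unconditional: a full-filter two-point limit makes `π₂ '' 𝒞` a subsingleton) and
  `twoPointDoubling_of_pointwiseLimitTwo` (the order-two limit at the axis pair `(0, 2e₀)` along `δ = 2^{-k}` is the convergence of
  `g(2^{k+1})/g(2^k)`, which gives item 6150 by `TwoHierarchies.stub_twoPointDoubling_of_dyadicPairRatio`);
* **`twoPointImageTD_and_doubling_iff_pointwiseLimitTwo`** — `stub_twoPointImageTD ∧ TwoPointDoubling ⟺ PointwiseLimit at order
  two`: the compactness item 6150 is ABSORBED into full-filter convergence of the pinned two-point function;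
* **`crux_iff_pointwiseLimitTwo_and_fibrewiseTD`** — `ExistsScaleCovariantLimit ⟺ (PointwiseLimit at order two) ∧ stub_fibrewiseTD`:
  an exact re-split of the crux (⟺ 6150 ∧ 4659, `crux_iff_doubling_and_totallyDisconnected`) into "the self-normalised critical
  two-point function has a scaling limit" and "cluster points sharing a two-point function are isolated from one another";
  `fibrewiseTD_of_clusterSetTotallyDisconnected` and `clusterSetTotallyDisconnected_of_twoPointImageTD_of_fibrewiseTD` are the two
  halves of 4659's birth glue (`isTotallyDisconnected_of_fibres`) restated over the verbatim sets.

References: H. Duminil-Copin, *100 years of the (critical) Ising model on the hypercubic lattice*, ICM 2022, §8.4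
[DuminilCopinICM2022]; the topology is folklore (connectedness of `ω`-limit sets, H. L. Smith, *Monotone Dynamical Systems*,
AMS 1995, §1.1). No `sorry`, no definitions.
-/

noncomputable section

namespace Summit.CriticalPhenomena.Ising3DConformalLimit.Cruxes.ExistsScaleCovariantLimit.FoldedCurrentRepulsion

open Filter Set
open scoped Topology
open Literature.Probability.LatticeModels
open Summit.CriticalPhenomena.Ising3DConformalLimit.MoebiusLimitExistsOnlyInteraction (rhoPin IsClusterPoint)
open Summit.CriticalPhenomena.Ising3DConformalLimit.Theses
open Summit.CriticalPhenomena.Ising3DConformalLimit.MoebiusLimitExistsNegative (tendsto_div_succ_nhdsGT)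
open Summit.CriticalPhenomena.Ising3DConformalLimit.ExistsScaleCovariantLimitNegative
  (one_div_succ_mem_Ioc crux_iff_orbitPrecompact_and_unique)
open Summit.CriticalPhenomena.Ising3DConformalLimit.ExistsScaleCovariantLimitNegative.Dyadic (cfg0_mem)
open Summit.CriticalPhenomena.Ising3DConformalLimit.Cruxes.ExistsScaleCovariantLimit.TwoHierarchies
  (rhoStar_eq_rhoPin clusterPoint_eqOn_of_pointwiseLimit stub_twoPointDoubling_of_dyadicPairRatio
    pointwiseLimit_of_existsScaleCovariantLimit)
open Summit.CriticalPhenomena.Ising3DConformalLimit.Cruxes.ExistsScaleCovariantLimit.TwoHierarchies.ItemMaps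
  (orbitPrecompact_iff_doubling)
open Uniqueness

/-! ## §1 Compactness + total disconnectedness of the two-point image ⟹ uniqueness of the two-point cluster function -/

/-- **Item 5955 ∧ `stub_twoPointImageTD` (item 4659's first birth stub, verbatim) ⟹ all cluster points of the pinned zoom share
ONE two-point function off the diagonal.** Proof: as in `clusterPointUnique_of_orbitPrecompact_of_totallyDisconnected` — the
normalised harmonic zoom is tight and asymptotically continuous for the level distances, every cluster point is one of its cluster
points, and a separation of the order-two image of its (normalised) cluster set by open sets of the product topology on
`(Fin 2 → ℝ³) → ℝ` pulls back along the continuous projection `S ↦ S 2` to a partition of the cluster set forbidden by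
`clusterSet_partition_false`. [folklore] -/
theorem clusterPointUniqueTwo_of_orbitPrecompact_of_twoPointImageTD :
    MonotoneRG.OrbitPrecompact →
    IsTotallyDisconnected ((fun S : CorrFamily 3 => S 2) '' {S : CorrFamily 3 | (∀ n x, x ∉ NonCoincident 3 n → S n x = 0) ∧
      ∃ u : ℕ → ℝ, (∀ k, u k ∈ Set.Ioc (0:ℝ) 1) ∧ Filter.Tendsto u Filter.atTop (nhds 0) ∧ ∀ n, TendstoLocallyUniformlyOn
        (fun k => rescaledCorrelator (criticalCorr 3) (fun δ : ℝ => (criticalTwoPoint 3 (Pi.single 0 ⌊δ⁻¹⌋)) ^ (-(1/2:ℝ))) n (u k))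
        (S n) Filter.atTop (NonCoincident 3 n)}) →
    ∀ S S' : CorrFamily 3, IsClusterPoint S → IsClusterPoint S' → Set.EqOn (S 2) (S' 2) (NonCoincident 3 2) := by
  intro hpc htd
  classical
  -- the level distances (support file B of F4)
  obtain ⟨lD, lD_self, lD_comm, lD_triangle, lD_mono, hlc⟩ := exists_levelDist
  -- normalisation: zero off the non-coincident configurations
  set nrm : CorrFamily 3 → CorrFamily 3 := fun S n x => if x ∈ NonCoincident 3 n then S n x else 0 with hnrm
  have nrm_eqOn : ∀ (S : CorrFamily 3) (n : ℕ), Set.EqOn (nrm S n) (S n) (NonCoincident 3 n) := by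
    intro S n x hx
    simp only [hnrm, if_pos hx]
  have nrm_zero : ∀ (S : CorrFamily 3) (n : ℕ) (x : Fin n → EuclideanSpace ℝ (Fin 3)),
      x ∉ NonCoincident 3 n → nrm S n x = 0 := by
    intro S n x hx
    simp only [hnrm, if_neg hx]
  -- the harmonic zoom, normalised
  set y : ℕ → CorrFamily 3 :=
    fun m => nrm (fun n => rescaledCorrelator (criticalCorr 3) rhoPin n (1 / ((m:ℝ) + 1))) with hy
  have ht : Tendsto (fun m : ℕ => 1 / ((m:ℝ) + 1)) atTop (𝓝[>] (0:ℝ)) := tendsto_div_succ_nhdsGT one_pos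
  have hyeq : ∀ (m n : ℕ), Set.EqOn (fun x => rescaledCorrelator (criticalCorr 3) rhoPin n (1 / ((m:ℝ) + 1)) x)
      (y m n) (NonCoincident 3 n) := by
    intro m n x hx
    simp only [hy]
    exact (nrm_eqOn (fun n => rescaledCorrelator (criticalCorr 3) rhoPin n (1 / ((m:ℝ) + 1))) n hx).symm
  -- dictionary: level convergence of `y ∘ φ` ↔ locally uniform convergence of the zoom along `1/(φ k + 1)`
  have hdict : ∀ (φ : ℕ → ℕ) (T : CorrFamily 3),
      (∀ j, Tendsto (fun k => lD j (y (φ k)) T) atTop (𝓝 0)) ↔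
        ∀ n, TendstoLocallyUniformlyOn
          (fun k => rescaledCorrelator (criticalCorr 3) rhoPin n (1 / (((φ k : ℕ) : ℝ) + 1))) (T n) atTop
          (NonCoincident 3 n) := by
    intro φ T
    rw [hlc (fun k => y (φ k)) T]
    exact forall_congr' fun n =>
      ⟨fun h => h.congr fun k => (hyeq (φ k) n).symm, fun h => h.congr fun k => hyeq (φ k) n⟩
  -- (T) tightness of `y`
  have hT : ∀ φ : ℕ → ℕ, StrictMono φ → ∃ ψ : ℕ → ℕ, StrictMono ψ ∧ ∃ T : CorrFamily 3,
      ∀ j, Tendsto (fun k => lD j (y (φ (ψ k))) T) atTop (𝓝 0) := by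
    intro φ hφ
    obtain ⟨ψ, hψ, T, hTc⟩ := tight_nhdsGT hpc (ht.comp hφ.tendsto_atTop)
    exact ⟨ψ, hψ, T, (hdict (φ ∘ ψ) T).2 hTc⟩
  -- (AC) asymptotic continuity of `y`
  have hAC : ∀ j, Tendsto (fun m => lD j (y m) (y (m + 1))) atTop (𝓝 0) := by
    intro j
    refine tendsto_of_subseq_tendsto fun φ₀ hφ₀ => ?_
    obtain ⟨κ, hκ, hmono⟩ := strictMono_subseq_of_tendsto_atTop hφ₀
    obtain ⟨ψ, hψ, T, hTc⟩ := tight_nhdsGT hpc (ht.comp hmono.tendsto_atTop)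
    have hms : StrictMono ((φ₀ ∘ κ) ∘ ψ) := hmono.comp hψ
    have h2 : ∀ n, TendstoLocallyUniformlyOn
        (fun l => rescaledCorrelator (criticalCorr 3) rhoPin n (1 / ((((φ₀ (κ (ψ l)) + 1 : ℕ)) : ℝ) + 1))) (T n)
        atTop (NonCoincident 3 n) := by
      intro n
      refine tluo_of_ratio hpc (u := fun l => 1 / (((φ₀ (κ (ψ l)) : ℕ) : ℝ) + 1))
        (w := fun l => 1 / ((((φ₀ (κ (ψ l)) + 1 : ℕ)) : ℝ) + 1)) ?_ ?_ ?_ hTc n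
      · exact ht.comp hms.tendsto_atTop
      · exact ht.comp ((tendsto_add_atTop_nat 1).comp hms.tendsto_atTop)
      · exact harmonic_ratio_tendsto.comp hms.tendsto_atTop
    have c1 : ∀ j, Tendsto (fun l => lD j (y (φ₀ (κ (ψ l)))) T) atTop (𝓝 0) := (hdict ((φ₀ ∘ κ) ∘ ψ) T).2 hTc
    have c2 : ∀ j, Tendsto (fun l => lD j (y (φ₀ (κ (ψ l)) + 1)) T) atTop (𝓝 0) :=
      (hdict (fun l => φ₀ (κ (ψ l)) + 1) T).2 h2
    exact ⟨κ ∘ ψ, near_of_conv (D := lD) lD_self lD_comm lD_triangle c1 c2 j⟩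
  -- the cluster set of `y` and its normalised image
  set C : Set (CorrFamily 3) :=
    {T | ∃ φ : ℕ → ℕ, StrictMono φ ∧ ∀ j, Tendsto (fun k => lD j (y (φ k)) T) atTop (𝓝 0)} with hC
  have hCiff : ∀ T, T ∈ C ↔ ∃ φ : ℕ → ℕ, StrictMono φ ∧ ∀ j, Tendsto (fun k => lD j (y (φ k)) T) atTop (𝓝 0) :=
    fun T => Iff.rfl
  set K : Set (CorrFamily 3) := nrm '' C with hK
  -- `K` lies in the set of item 4659
  have hKsub : K ⊆ {S : CorrFamily 3 | (∀ n x, x ∉ NonCoincident 3 n → S n x = 0) ∧ ∃ u : ℕ → ℝ,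
      (∀ k, u k ∈ Set.Ioc (0:ℝ) 1) ∧ Tendsto u atTop (nhds 0) ∧ ∀ n, TendstoLocallyUniformlyOn
        (fun k => rescaledCorrelator (criticalCorr 3)
          (fun δ : ℝ => (criticalTwoPoint 3 (Pi.single 0 ⌊δ⁻¹⌋)) ^ (-(1/2:ℝ))) n (u k))
        (S n) atTop (NonCoincident 3 n)} := by
    rintro _ ⟨T, ⟨φ, hφ, hTc⟩, rfl⟩
    refine ⟨fun n x hx => nrm_zero T n x hx, fun k => 1 / (((φ k : ℕ) : ℝ) + 1),
      fun k => one_div_succ_mem_Ioc _, (tendsto_nhdsWithin_iff.1 (ht.comp hφ.tendsto_atTop)).1, fun n => ?_⟩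
    rw [rhoStar_eq_rhoPin]
    exact (((hdict φ T).1 hTc) n).congr_right (nrm_eqOn T n).symm
  -- the order-two image of `K` lies in the order-two image of the set of item 4659
  set K₂ : Set ((Fin 2 → EuclideanSpace ℝ (Fin 3)) → ℝ) := (fun S : CorrFamily 3 => S 2) '' K with hK₂
  have hK₂sub : K₂ ⊆ (fun S : CorrFamily 3 => S 2) '' {S : CorrFamily 3 | (∀ n x, x ∉ NonCoincident 3 n → S n x = 0) ∧
      ∃ u : ℕ → ℝ, (∀ k, u k ∈ Set.Ioc (0:ℝ) 1) ∧ Tendsto u atTop (nhds 0) ∧ ∀ n, TendstoLocallyUniformlyOn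
        (fun k => rescaledCorrelator (criticalCorr 3)
          (fun δ : ℝ => (criticalTwoPoint 3 (Pi.single 0 ⌊δ⁻¹⌋)) ^ (-(1/2:ℝ))) n (u k))
        (S n) atTop (NonCoincident 3 n)} := Set.image_mono hKsub
  -- pointwise convergence AT ORDER TWO of normalised families from level convergence
  have hptw : ∀ (a : ℕ → CorrFamily 3) (T : CorrFamily 3),
      (∀ j, Tendsto (fun k => lD j (a k) T) atTop (𝓝 0)) → Tendsto (fun k => nrm (a k) 2) atTop (𝓝 (nrm T 2)) := by
    intro a T ha
    rw [tendsto_pi_nhds]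
    intro x
    by_cases hx : x ∈ NonCoincident 3 2
    · have h1 := (((hlc a T).1 ha) 2).tendsto_at hx
      simp only [hnrm, if_pos hx]
      exact h1
    · simp only [hnrm, if_neg hx]
      exact tendsto_const_nhds
  -- the two cluster points
  intro S S' hS hS'
  have hmem : ∀ {T : CorrFamily 3}, IsClusterPoint T → T ∈ C := by
    intro T hT
    obtain ⟨φ, hφ, hconv⟩ := exists_harmonic_subseq hpc T hT
    exact ⟨φ, hφ, (hdict φ T).2 hconv⟩
  have hSK : nrm S 2 ∈ K₂ := ⟨nrm S, ⟨S, hmem hS, rfl⟩, rfl⟩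
  have hS'K : nrm S' 2 ∈ K₂ := ⟨nrm S', ⟨S', hmem hS', rfl⟩, rfl⟩
  suffices heq : nrm S 2 = nrm S' 2 by
    intro x hx
    rw [← nrm_eqOn S 2 hx, ← nrm_eqOn S' 2 hx, heq]
  by_contra hne
  -- `K₂` is totally disconnected (the stub) and has two points, hence is not preconnected
  have hnp : ¬ IsPreconnected K₂ := fun hp => hne (htd K₂ hK₂sub hp hSK hS'K)
  obtain ⟨U, V, hU, hV, hKUV, hKU, hKV, hKUVe⟩ : ∃ U V : Set ((Fin 2 → EuclideanSpace ℝ (Fin 3)) → ℝ),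
      IsOpen U ∧ IsOpen V ∧ K₂ ⊆ U ∪ V ∧ (K₂ ∩ U).Nonempty ∧ (K₂ ∩ V).Nonempty ∧ ¬ (K₂ ∩ (U ∩ V)).Nonempty := by
    by_contra h
    apply hnp
    intro U V hU hV hKUV hKU hKV
    by_contra h'
    exact h ⟨U, V, hU, hV, hKUV, hKU, hKV, h'⟩
  have hdis : ∀ Z ∈ K₂, Z ∈ U → Z ∉ V := fun Z hZ hZU hZV => hKUVe ⟨Z, hZ, hZU, hZV⟩
  have hK₂mem : ∀ {T : CorrFamily 3}, T ∈ C → nrm T 2 ∈ K₂ := fun {T} hTC => ⟨nrm T, ⟨T, hTC, rfl⟩, rfl⟩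
  -- closure of the two parts under limits from the cluster set
  have hcl : ∀ {W W' : Set ((Fin 2 → EuclideanSpace ℝ (Fin 3)) → ℝ)}, K₂ ⊆ W ∪ W' → IsOpen W' →
      (∀ Z ∈ K₂, Z ∈ W → Z ∉ W') →
      ∀ (a : ℕ → CorrFamily 3) (T : CorrFamily 3), (∀ k, a k ∈ C ∧ nrm (a k) 2 ∈ W) → T ∈ C →
        (∀ j, Tendsto (fun k => lD j (a k) T) atTop (𝓝 0)) → nrm T 2 ∈ W := by
    intro W W' hKWW' hW' hdis' a T ha hTC haT
    have hTK : nrm T 2 ∈ K₂ := hK₂mem hTC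
    rcases hKWW' hTK with h | h
    · exact h
    · exfalso
      have hev : ∀ᶠ k in atTop, nrm (a k) 2 ∈ W' := (hptw a T haT).eventually (hW'.mem_nhds h)
      obtain ⟨k, hk⟩ := hev.exists
      exact hdis' _ (hK₂mem (ha k).1) (ha k).2 hk
  -- the abstract connectedness theorem (support file A of F4)
  refine clusterSet_partition_false (D := lD) lD_self lD_comm lD_triangle lD_mono hT hAC hCiff
    (A := {T | T ∈ C ∧ nrm T 2 ∈ U}) (B := {T | T ∈ C ∧ nrm T 2 ∈ V})
    (fun T hT => hT.1) (fun T hT => hT.1) ?_ ?_ ?_ ?_ ?_ ?_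
  · intro T hT
    rcases hKUV (hK₂mem hT) with h | h
    · exact Or.inl ⟨hT, h⟩
    · exact Or.inr ⟨hT, h⟩
  · intro T hTA hTB
    exact hdis _ (hK₂mem hTA.1) hTA.2 hTB.2
  · intro a T ha hTC haT
    exact ⟨hTC, hcl hKUV hV hdis a T ha hTC haT⟩
  · intro b T hb hTC hbT
    exact ⟨hTC, hcl (W := V) (W' := U) (fun Z hZ => (hKUV hZ).symm) hU
      (fun Z hZ hZV hZU => hdis Z hZ hZU hZV) b T hb hTC hbT⟩
  · obtain ⟨_, ⟨_, ⟨T, hT, rfl⟩, rfl⟩, hTU⟩ := hKU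
    exact ⟨T, hT, hTU⟩
  · obtain ⟨_, ⟨_, ⟨T, hT, rfl⟩, rfl⟩, hTV⟩ := hKV
    exact ⟨T, hT, hTV⟩

/-! ## §2 Uniqueness at order two + compactness ⟹ the full-filter two-point limit -/

/-- **Item 5955 ∧ uniqueness of the two-point cluster function ⟹ item 6153 `PointwiseLimit` AT ORDER TWO**: the pinned
two-point function `ρ★(δ)² ⟨σ_{⌊x/δ⌋}σ_{⌊y/δ⌋}⟩_{β_c}` converges as `δ → 0⁺` at every non-coincident pair. Proof: `𝓝[>] 0` is
countably generated, so it suffices to treat sequences `u_k → 0⁺`; every subsequence has a sub-subsequence along which the zoom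
converges at all orders to a cluster point (`tight_nhdsGT`), whose two-point function is that of a fixed reference cluster point.
[folklore] -/
theorem pointwiseLimitTwo_of_orbitPrecompact_of_clusterPointUniqueTwo (hpc : MonotoneRG.OrbitPrecompact)
    (huniq : ∀ S S' : CorrFamily 3, IsClusterPoint S → IsClusterPoint S' → Set.EqOn (S 2) (S' 2) (NonCoincident 3 2)) :
    ∀ x ∈ NonCoincident 3 2, ∃ l : ℝ, Filter.Tendsto (fun δ : ℝ => rescaledCorrelator (criticalCorr 3)
      (fun δ : ℝ => (criticalTwoPoint 3 (Pi.single 0 ⌊δ⁻¹⌋)) ^ (-(1/2:ℝ))) 2 δ x) (nhdsWithin 0 (Set.Ioi 0)) (nhds l) := by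
  intro x hx
  rw [rhoStar_eq_rhoPin]
  -- a reference cluster point along the harmonic meshes
  have ht : Tendsto (fun m : ℕ => 1 / ((m:ℝ) + 1)) atTop (𝓝[>] (0:ℝ)) := tendsto_div_succ_nhdsGT one_pos
  obtain ⟨φ₀, hφ₀, S₀, hS₀⟩ := tight_nhdsGT hpc ht
  have hcp₀ : IsClusterPoint S₀ := ⟨_, ht.comp hφ₀.tendsto_atTop, hS₀⟩
  refine ⟨S₀ 2 x, ?_⟩
  refine tendsto_of_seq_tendsto fun u hu => ?_
  refine tendsto_of_subseq_tendsto fun ψ hψ => ?_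
  have hu' : Tendsto (u ∘ ψ) atTop (𝓝[>] (0:ℝ)) := hu.comp hψ
  obtain ⟨φ, hφ, T, hT⟩ := tight_nhdsGT hpc hu'
  have hcpT : IsClusterPoint T := ⟨_, hu'.comp hφ.tendsto_atTop, hT⟩
  refine ⟨φ, ?_⟩
  have h1 : Tendsto (fun k => rescaledCorrelator (criticalCorr 3) rhoPin 2 ((u ∘ ψ) (φ k)) x) atTop (𝓝 (T 2 x)) :=
    (hT 2).tendsto_at hx
  rw [huniq T S₀ hcpT hcp₀ hx] at h1
  exact h1

/-! ## §3 The full-filter two-point limit gives back the stub and item 6150 -/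

/-- **`PointwiseLimit` at order two ⟹ `stub_twoPointImageTD`** (unconditionally): every member of item 4659's set is a cluster
point along a sequence `u_k → 0⁺`, so its two-point function is the full-filter limit on the non-coincident pairs and `0`
elsewhere — the order-two image is a subsingleton, hence totally disconnected. [folklore] -/
theorem twoPointImageTD_of_pointwiseLimitTwo
    (hPL : ∀ x ∈ NonCoincident 3 2, ∃ l : ℝ, Filter.Tendsto (fun δ : ℝ => rescaledCorrelator (criticalCorr 3)
      (fun δ : ℝ => (criticalTwoPoint 3 (Pi.single 0 ⌊δ⁻¹⌋)) ^ (-(1/2:ℝ))) 2 δ x) (nhdsWithin 0 (Set.Ioi 0)) (nhds l)) :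
    IsTotallyDisconnected ((fun S : CorrFamily 3 => S 2) '' {S : CorrFamily 3 | (∀ n x, x ∉ NonCoincident 3 n → S n x = 0) ∧
      ∃ u : ℕ → ℝ, (∀ k, u k ∈ Set.Ioc (0:ℝ) 1) ∧ Filter.Tendsto u Filter.atTop (nhds 0) ∧ ∀ n, TendstoLocallyUniformlyOn
        (fun k => rescaledCorrelator (criticalCorr 3) (fun δ : ℝ => (criticalTwoPoint 3 (Pi.single 0 ⌊δ⁻¹⌋)) ^ (-(1/2:ℝ))) n (u k))
        (S n) Filter.atTop (NonCoincident 3 n)}) := by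
  -- a subsingleton is totally disconnected
  suffices hsub : (((fun S : CorrFamily 3 => S 2)) '' {S : CorrFamily 3 | (∀ n x, x ∉ NonCoincident 3 n → S n x = 0) ∧
      ∃ u : ℕ → ℝ, (∀ k, u k ∈ Set.Ioc (0:ℝ) 1) ∧ Filter.Tendsto u Filter.atTop (nhds 0) ∧ ∀ n, TendstoLocallyUniformlyOn
        (fun k => rescaledCorrelator (criticalCorr 3) (fun δ : ℝ => (criticalTwoPoint 3 (Pi.single 0 ⌊δ⁻¹⌋)) ^ (-(1/2:ℝ))) n (u k))
        (S n) Filter.atTop (NonCoincident 3 n)}).Subsingleton from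
    fun t ht _ => hsub.anti ht
  rintro _ ⟨T, ⟨hTn, u, hu1, hu0, hTc⟩, rfl⟩ _ ⟨T', ⟨hT'n, u', hu1', hu0', hT'c⟩, rfl⟩
  show T 2 = T' 2
  funext x
  by_cases hx : x ∈ NonCoincident 3 2
  · obtain ⟨l, hl⟩ := hPL x hx
    have hu : Tendsto u atTop (𝓝[>] (0:ℝ)) :=
      tendsto_nhdsWithin_iff.2 ⟨hu0, Eventually.of_forall fun k => (hu1 k).1⟩
    have hu' : Tendsto u' atTop (𝓝[>] (0:ℝ)) :=
      tendsto_nhdsWithin_iff.2 ⟨hu0', Eventually.of_forall fun k => (hu1' k).1⟩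
    have e1 : T 2 x = l := tendsto_nhds_unique ((hTc 2).tendsto_at hx) (hl.comp hu)
    have e2 : T' 2 x = l := tendsto_nhds_unique ((hT'c 2).tendsto_at hx) (hl.comp hu')
    rw [e1, e2]
  · rw [hTn 2 x hx, hT'n 2 x hx]

/-- **`PointwiseLimit` at order two ⟹ item 6150 `TwoPointDoubling`**: at the axis pair `(0, 2e₀)` and along `δ = 2^{-k}` the pinned
two-point function is `g(2^{k+1})/g(2^k)`, and convergence of that one sequence gives all-scale axis doubling
(`TwoHierarchies.stub_twoPointDoubling_of_dyadicPairRatio`). [cite: AizenmanDuminilCopinAnnals2021, arXiv:1912.07973 Remark 5.10] -/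
theorem twoPointDoubling_of_pointwiseLimitTwo
    (hPL : ∀ x ∈ NonCoincident 3 2, ∃ l : ℝ, Filter.Tendsto (fun δ : ℝ => rescaledCorrelator (criticalCorr 3)
      (fun δ : ℝ => (criticalTwoPoint 3 (Pi.single 0 ⌊δ⁻¹⌋)) ^ (-(1/2:ℝ))) 2 δ x) (nhdsWithin 0 (Set.Ioi 0)) (nhds l)) :
    MirrorHoelderCompactness.TwoPointDoubling := by
  obtain ⟨l, hl⟩ := hPL _ (cfg0_mem (s := (2:ℝ)) two_ne_zero)
  rw [rhoStar_eq_rhoPin] at hl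
  refine stub_twoPointDoubling_of_dyadicPairRatio ⟨l, ?_⟩
  have h2 : Tendsto (fun k : ℕ => ((2:ℝ) ^ k)⁻¹) atTop (𝓝[>] (0:ℝ)) :=
    tendsto_nhdsWithin_iff.2 ⟨tendsto_inv_atTop_zero.comp (tendsto_pow_atTop_atTop_of_one_lt one_lt_two),
      Eventually.of_forall fun k => Set.mem_Ioi.2 (by positivity)⟩
  exact hl.comp h2

/-! ## §4 The dictionary and the re-split of the crux -/

/-- **`stub_twoPointImageTD ∧ item 6150 ⟺ item 6153 at order two.** Total disconnectedness of the two-point image of the cluster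
set together with all-scale axis doubling is EXACTLY full-filter convergence of the pinned critical two-point function: the
compactness item is absorbed. [folklore] -/
theorem twoPointImageTD_and_doubling_iff_pointwiseLimitTwo :
    (IsTotallyDisconnected ((fun S : CorrFamily 3 => S 2) '' {S : CorrFamily 3 | (∀ n x, x ∉ NonCoincident 3 n → S n x = 0) ∧
      ∃ u : ℕ → ℝ, (∀ k, u k ∈ Set.Ioc (0:ℝ) 1) ∧ Filter.Tendsto u Filter.atTop (nhds 0) ∧ ∀ n, TendstoLocallyUniformlyOn
        (fun k => rescaledCorrelator (criticalCorr 3) (fun δ : ℝ => (criticalTwoPoint 3 (Pi.single 0 ⌊δ⁻¹⌋)) ^ (-(1/2:ℝ))) n (u k))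
        (S n) Filter.atTop (NonCoincident 3 n)}) ∧ MirrorHoelderCompactness.TwoPointDoubling) ↔
    ∀ x ∈ NonCoincident 3 2, ∃ l : ℝ, Filter.Tendsto (fun δ : ℝ => rescaledCorrelator (criticalCorr 3)
      (fun δ : ℝ => (criticalTwoPoint 3 (Pi.single 0 ⌊δ⁻¹⌋)) ^ (-(1/2:ℝ))) 2 δ x) (nhdsWithin 0 (Set.Ioi 0)) (nhds l) := by
  constructor
  · rintro ⟨htd, hD⟩
    have hpc : MonotoneRG.OrbitPrecompact := orbitPrecompact_iff_doubling.2 hD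
    exact pointwiseLimitTwo_of_orbitPrecompact_of_clusterPointUniqueTwo hpc
      (clusterPointUniqueTwo_of_orbitPrecompact_of_twoPointImageTD hpc htd)
  · intro hPL
    exact ⟨twoPointImageTD_of_pointwiseLimitTwo hPL, twoPointDoubling_of_pointwiseLimitTwo hPL⟩

/-- Item 4659 ⟹ `stub_fibrewiseTD` (each fibre is a subset of the cluster set). [folklore] -/
theorem fibrewiseTD_of_clusterSetTotallyDisconnected (h : ClusterRigidity.ClusterSetTotallyDisconnected) :
    ∀ G : (Fin 2 → EuclideanSpace ℝ (Fin 3)) → ℝ, IsTotallyDisconnected {S : CorrFamily 3 | ((∀ n x, x ∉ NonCoincident 3 n → S n x = 0) ∧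
      ∃ u : ℕ → ℝ, (∀ k, u k ∈ Set.Ioc (0:ℝ) 1) ∧ Filter.Tendsto u Filter.atTop (nhds 0) ∧ ∀ n, TendstoLocallyUniformlyOn
        (fun k => rescaledCorrelator (criticalCorr 3) (fun δ : ℝ => (criticalTwoPoint 3 (Pi.single 0 ⌊δ⁻¹⌋)) ^ (-(1/2:ℝ))) n (u k))
        (S n) Filter.atTop (NonCoincident 3 n)) ∧ S 2 = G} :=
  fun _ t ht hp => h t (fun _ hS => (ht hS).1) hp

/-- `stub_twoPointImageTD ∧ stub_fibrewiseTD ⟹ item 4659` (4659's birth glue `isTotallyDisconnected_of_fibres` over the verbatim sets: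
a preconnected `t ⊆ 𝒞` has preconnected image under the continuous projection `S ↦ S 2`, hence a single two-point function, so `t`
lies in one fibre). [folklore] -/
theorem clusterSetTotallyDisconnected_of_twoPointImageTD_of_fibrewiseTD
    (h1 : IsTotallyDisconnected ((fun S : CorrFamily 3 => S 2) '' {S : CorrFamily 3 | (∀ n x, x ∉ NonCoincident 3 n → S n x = 0) ∧
      ∃ u : ℕ → ℝ, (∀ k, u k ∈ Set.Ioc (0:ℝ) 1) ∧ Filter.Tendsto u Filter.atTop (nhds 0) ∧ ∀ n, TendstoLocallyUniformlyOn
        (fun k => rescaledCorrelator (criticalCorr 3) (fun δ : ℝ => (criticalTwoPoint 3 (Pi.single 0 ⌊δ⁻¹⌋)) ^ (-(1/2:ℝ))) n (u k))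
        (S n) Filter.atTop (NonCoincident 3 n)}))
    (h2 : ∀ G : (Fin 2 → EuclideanSpace ℝ (Fin 3)) → ℝ, IsTotallyDisconnected {S : CorrFamily 3 | ((∀ n x, x ∉ NonCoincident 3 n → S n x = 0) ∧
      ∃ u : ℕ → ℝ, (∀ k, u k ∈ Set.Ioc (0:ℝ) 1) ∧ Filter.Tendsto u Filter.atTop (nhds 0) ∧ ∀ n, TendstoLocallyUniformlyOn
        (fun k => rescaledCorrelator (criticalCorr 3) (fun δ : ℝ => (criticalTwoPoint 3 (Pi.single 0 ⌊δ⁻¹⌋)) ^ (-(1/2:ℝ))) n (u k))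
        (S n) Filter.atTop (NonCoincident 3 n)) ∧ S 2 = G}) :
    ClusterRigidity.ClusterSetTotallyDisconnected := by
  intro t ht hp
  rcases t.eq_empty_or_nonempty with rfl | ⟨S₀, hS₀⟩
  · exact Set.subsingleton_empty
  have hcont : Continuous (fun S : CorrFamily 3 => S 2) := continuous_apply 2
  have himg : (((fun S : CorrFamily 3 => S 2)) '' t).Subsingleton :=
    h1 _ (Set.image_mono ht) (hp.image _ hcont.continuousOn)
  have hsub : t ⊆ {S : CorrFamily 3 | ((∀ n x, x ∉ NonCoincident 3 n → S n x = 0) ∧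
      ∃ u : ℕ → ℝ, (∀ k, u k ∈ Set.Ioc (0:ℝ) 1) ∧ Filter.Tendsto u Filter.atTop (nhds 0) ∧ ∀ n, TendstoLocallyUniformlyOn
        (fun k => rescaledCorrelator (criticalCorr 3) (fun δ : ℝ => (criticalTwoPoint 3 (Pi.single 0 ⌊δ⁻¹⌋)) ^ (-(1/2:ℝ))) n (u k))
        (S n) Filter.atTop (NonCoincident 3 n)) ∧ S 2 = S₀ 2} :=
    fun S hS => ⟨ht hS, himg ⟨S, hS, rfl⟩ ⟨S₀, hS₀, rfl⟩⟩
  exact h2 (S₀ 2) t hsub hp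

/-- **THE CRUX, RE-SPLIT AT ORDER TWO: `ExistsScaleCovariantLimit ⟺ (item 6153 at order two) ∧ stub_fibrewiseTD`** — existence of
the scale-covariant continuum limit of all critical `ℤ³` Ising correlators is EXACTLY (i) full-filter convergence of the
self-normalised critical two-point function `⟨σ_{⌊x/δ⌋}σ_{⌊y/δ⌋}⟩_{β_c}/⟨σ₀σ_{⌊1/δ⌋e₀}⟩_{β_c}` at every pair `x ≠ y`, and (ii) total
disconnectedness of every two-point fibre of the cluster set (item 4659's load-bearing birth stub). Compared with
`crux_iff_doubling_and_totallyDisconnected` (crux ⟺ 6150 ∧ 4659), the compactness item 6150 and the order-two part of 4659 merge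
into the classical statement (i). [folklore] -/
theorem crux_iff_pointwiseLimitTwo_and_fibrewiseTD :
    HyperoctahedralRP.ExistsScaleCovariantLimit ↔
    ((∀ x ∈ NonCoincident 3 2, ∃ l : ℝ, Filter.Tendsto (fun δ : ℝ => rescaledCorrelator (criticalCorr 3)
      (fun δ : ℝ => (criticalTwoPoint 3 (Pi.single 0 ⌊δ⁻¹⌋)) ^ (-(1/2:ℝ))) 2 δ x) (nhdsWithin 0 (Set.Ioi 0)) (nhds l)) ∧
     ∀ G : (Fin 2 → EuclideanSpace ℝ (Fin 3)) → ℝ, IsTotallyDisconnected {S : CorrFamily 3 | ((∀ n x, x ∉ NonCoincident 3 n → S n x = 0) ∧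
      ∃ u : ℕ → ℝ, (∀ k, u k ∈ Set.Ioc (0:ℝ) 1) ∧ Filter.Tendsto u Filter.atTop (nhds 0) ∧ ∀ n, TendstoLocallyUniformlyOn
        (fun k => rescaledCorrelator (criticalCorr 3) (fun δ : ℝ => (criticalTwoPoint 3 (Pi.single 0 ⌊δ⁻¹⌋)) ^ (-(1/2:ℝ))) n (u k))
        (S n) Filter.atTop (NonCoincident 3 n)) ∧ S 2 = G}) := by
  constructor
  · intro h
    exact ⟨pointwiseLimit_of_existsScaleCovariantLimit h 2,
      fibrewiseTD_of_clusterSetTotallyDisconnected (crux_iff_doubling_and_totallyDisconnected.1 h).2⟩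
  · rintro ⟨hPL, h2⟩
    exact crux_iff_doubling_and_totallyDisconnected.2 ⟨twoPointDoubling_of_pointwiseLimitTwo hPL,
      clusterSetTotallyDisconnected_of_twoPointImageTD_of_fibrewiseTD (twoPointImageTD_of_pointwiseLimitTwo hPL) h2⟩

/-- The same re-split for route PositivityBegetsConformality's copy of the shared decl (same body). [folklore] -/
theorem pbc_crux_iff_pointwiseLimitTwo_and_fibrewiseTD :
    PositivityBegetsConformality.ExistsScaleCovariantLimit ↔
    ((∀ x ∈ NonCoincident 3 2, ∃ l : ℝ, Filter.Tendsto (fun δ : ℝ => rescaledCorrelator (criticalCorr 3)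
      (fun δ : ℝ => (criticalTwoPoint 3 (Pi.single 0 ⌊δ⁻¹⌋)) ^ (-(1/2:ℝ))) 2 δ x) (nhdsWithin 0 (Set.Ioi 0)) (nhds l)) ∧
     ∀ G : (Fin 2 → EuclideanSpace ℝ (Fin 3)) → ℝ, IsTotallyDisconnected {S : CorrFamily 3 | ((∀ n x, x ∉ NonCoincident 3 n → S n x = 0) ∧
      ∃ u : ℕ → ℝ, (∀ k, u k ∈ Set.Ioc (0:ℝ) 1) ∧ Filter.Tendsto u Filter.atTop (nhds 0) ∧ ∀ n, TendstoLocallyUniformlyOn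
        (fun k => rescaledCorrelator (criticalCorr 3) (fun δ : ℝ => (criticalTwoPoint 3 (Pi.single 0 ⌊δ⁻¹⌋)) ^ (-(1/2:ℝ))) n (u k))
        (S n) Filter.atTop (NonCoincident 3 n)) ∧ S 2 = G}) :=
  crux_iff_pointwiseLimitTwo_and_fibrewiseTD

end Summit.CriticalPhenomena.Ising3DConformalLimit.Cruxes.ExistsScaleCovariantLimit.FoldedCurrentRepulsion

end
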